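import Mathlib
import Summits.ValiantsHypothesis.ValiantsHypothesis.Theorems.NewtonUnitEquationsNewtonTauWeakVdpDefs

/-!
# `NewtonTauWeak` (stmt-ValiantsHypothesis-5904), line `euler-wronskian-vdp`: assembly of VdP

Stub `stub_vdpAssembly` of the lead's skeleton: the Newton-polygon Voorhoeve–van der Poorten bound
`V(Σ_{i<k} u_i) ≤ 4 (k+1)² · max_T V(W(u_T))`, assembled from three statements proved in sibling
files and taken here as hypotheses: the STRUCTURE of the tops of a sum of an independent family
(`hS`: for generic `w` the top `e` of `Σ u` satisfies `e + top W_j = top W_{j+1}` for some flag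
index `j`), the CHART PAIR COUNT (`hC`: along the chart `(σ, t)` the realised pairs
`(top G, top F)` number at most `V(F) + V(G)`) and the VERTEX CHARTS (`hV`:
`V(s) ≤ #T₊(s) + #T₋(s)`).

Proof.
* `VdpAssembly.exists_carrier`: `s = Σ u` is carried, with nonzero coefficients, by a linearly
  independent increasing sub-family: `s = Σ_{i<n} c_i u_{g i}`, `g` strictly monotone, `c_i ≠ 0`,
  `(c_i u_{g i})_i` independent (a maximal independent sub-family spans; keep the support of the
  representing combination). Every flag Wronskian of this family is, up to the nonzero scalar
  `Π_i C(c_i) ∈ ℂ[μ]` (column scaling, `VdpAssembly.eulerWronskian_baseChange_smul`), the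
  Euler–Wronskian of a sub-family `u_T` of `u` enumerated increasingly
  (`VdpAssembly.newtonVertexCount_eulerWronskian_le_wronskianSup`), so its vertex count is
  `≤ wronskianSup u`.
* `VdpAssembly.ncard_tops_le`: by `hS`, every chart top `e` of `s` is a difference `b - a` of a
  realised pair of tops of consecutive flag Wronskians, so `#T_σ(s) ≤ Σ_j #P_{σ,j}`.
* `stub_vdpAssembly`: `V(s) ≤ #T₊ + #T₋ ≤ 2 · Σ_{j<n} (V(W_{j+1}) + V(W_j)) ≤ 4 n · wronskianSup u`
  and `n ≤ k ≤ (k+1)²`.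
[KPT arXiv:1205.1015 §2 (real analogue); folklore]
-/

-- the namespace mandated for this Theorems file repeats the component `ValiantsHypothesis`
set_option linter.dupNamespace false

noncomputable section

namespace Summit.ValiantsHypothesis.ValiantsHypothesis.Theorems.NewtonUnitEquationsNewtonTauWeak

open scoped BigOperators Polynomial
open MvPolynomial
open Literature.Computability.AlgebraicComplexity (newtonVertexCount)
open Summit.ValiantsHypothesis.ValiantsHypothesis.Theorems.NewtonTauWeakVdp

namespace VdpAssembly

/-! ## Column scaling and increasing reindexing of Euler–Wronskians -/

/-- **Column scaling**: `W(c_0 v_0, …, c_{r-1} v_{r-1}) = (Π_b C(c_b)) • W(v)`. [folklore] -/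
theorem eulerWronskian_baseChange_smul {r : ℕ} (c : Fin r → ℂ)
    (v : Fin r → MvPolynomial (Fin 2) ℂ) :
    eulerWronskian (fun b => baseChange (c b • v b)) =
      (∏ b, Polynomial.C (c b)) • eulerWronskian (fun b => baseChange (v b)) := by
  have hM : (Matrix.of fun a b : Fin r => euler^[(a : ℕ)] (baseChange (c b • v b))) =
      Matrix.of fun a b : Fin r => C (Polynomial.C (c b)) *
        (Matrix.of fun a b : Fin r => euler^[(a : ℕ)] (baseChange (v b))) a b := by
    refine Matrix.ext fun a b => ?_
    simp only [Matrix.of_apply]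
    rw [baseChange_smul, euler_iterate_smul, smul_eq_C_mul]
  unfold eulerWronskian
  rw [hM, Matrix.det_mul_row, smul_eq_C_mul, map_prod]

/-- A nonzero scalar of the slope ring does not move the Newton polygon. [folklore] -/
theorem newtonVertexCount_smul {a : Slope} (ha : a ≠ 0) (p : MvPolynomial (Fin 2) Slope) :
    newtonVertexCount (a • p) = newtonVertexCount p :=
  newtonVertexCount_congr_support (support_smul_eq ha p)

/-- Transport of an increasingly enumerated Euler–Wronskian along an equality of lengths.
[folklore] -/
theorem eulerWronskian_orderEmbOfFin_cast {k n m : ℕ} (h : n = m)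
    (u : Fin k → MvPolynomial (Fin 2) ℂ) (T : Finset (Fin k)) (hn : T.card = n)
    (hm : T.card = m) :
    eulerWronskian (fun b : Fin n => baseChange (u (T.orderEmbOfFin hn b))) =
      eulerWronskian (fun b : Fin m => baseChange (u (T.orderEmbOfFin hm b))) := by
  subst h
  rfl

/-- **Increasing reindexing**: the Euler–Wronskian of a sub-family of `u` taken along a strictly
monotone map is one of the Wronskians `W(u_T)` entering `wronskianSup u`. [folklore] -/
theorem newtonVertexCount_eulerWronskian_le_wronskianSup {k m : ℕ}
    (u : Fin k → MvPolynomial (Fin 2) ℂ) {φ : Fin m → Fin k} (hφ : StrictMono φ) :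
    newtonVertexCount (eulerWronskian fun b => baseChange (u (φ b))) ≤ wronskianSup u := by
  classical
  obtain ⟨T, hTdef⟩ : ∃ T : Finset (Fin k), Finset.univ.image φ = T := ⟨_, rfl⟩
  have hT : T.card = m := by
    rw [← hTdef, Finset.card_image_of_injective _ hφ.injective, Finset.card_univ,
      Fintype.card_fin]
  have hφT : φ = T.orderEmbOfFin hT :=
    Finset.orderEmbOfFin_unique hT
      (fun x => hTdef ▸ Finset.mem_image_of_mem φ (Finset.mem_univ x)) hφ
  have key : (eulerWronskian fun b => baseChange (u (φ b))) =
      eulerWronskian fun b : Fin T.card => baseChange (u (T.orderEmbOfFin rfl b)) := by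
    rw [hφT]
    exact eulerWronskian_orderEmbOfFin_cast hT.symm u T hT rfl
  rw [key]
  exact Finset.le_sup (f := fun T : Finset (Fin k) =>
    newtonVertexCount (eulerWronskian fun b : Fin T.card =>
      baseChange (u (T.orderEmbOfFin rfl b)))) (Finset.mem_univ T)

/-- The flag Wronskians of a scaled increasing sub-family `(c_i u_{g i})_i` (`c_i ≠ 0`) have
vertex count at most `wronskianSup u`. [folklore] -/
theorem newtonVertexCount_flagW_le {k n : ℕ} (u : Fin k → MvPolynomial (Fin 2) ℂ)
    {g : Fin n → Fin k} (hg : StrictMono g) {c : Fin n → ℂ} (hc : ∀ i, c i ≠ 0)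
    (j : Fin (n + 1)) :
    newtonVertexCount (flagW (fun i => c i • u (g i)) j) ≤ wronskianSup u := by
  show newtonVertexCount (eulerWronskian fun b : Fin (j : ℕ) =>
    baseChange (c (Fin.castLE (Nat.lt_succ_iff.mp j.isLt) b) •
      u (g (Fin.castLE (Nat.lt_succ_iff.mp j.isLt) b)))) ≤ wronskianSup u
  rw [eulerWronskian_baseChange_smul (fun b => c (Fin.castLE _ b))
      (fun b => u (g (Fin.castLE _ b))),
    newtonVertexCount_smul
      (Finset.prod_ne_zero_iff.mpr fun b _ => Polynomial.C_ne_zero.mpr (hc _))]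
  exact newtonVertexCount_eulerWronskian_le_wronskianSup u (hg.comp (Fin.strictMono_castLE _))

/-! ## The independent carrier -/

/-- Sums over a finset as sums along its increasing enumeration. [folklore] -/
theorem sum_orderEmbOfFin {k : ℕ} {M : Type*} [AddCommMonoid M] (s : Finset (Fin k))
    (f : Fin k → M) : ∑ i : Fin s.card, f (s.orderEmbOfFin rfl i) = ∑ x ∈ s, f x := by
  conv_rhs => rw [← Finset.map_orderEmbOfFin_univ s rfl]
  rw [Finset.sum_map]
  rfl

/-- **Independent carrier**: `Σ_i u_i` is a combination with nonzero coefficients of a linearly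
independent increasing sub-family of `u`; all flag Wronskians of the scaled sub-family have
vertex count `≤ wronskianSup u`. [folklore] -/
theorem exists_carrier {k : ℕ} (u : Fin k → MvPolynomial (Fin 2) ℂ) :
    ∃ (n : ℕ) (u' : Fin n → MvPolynomial (Fin 2) ℂ), n ≤ k ∧ LinearIndependent ℂ u' ∧
      ∑ i, u' i = ∑ i, u i ∧
        ∀ j : Fin (n + 1), newtonVertexCount (flagW u' j) ≤ wronskianSup u := by
  classical
  obtain ⟨b, -, -, hspan, hli⟩ := exists_linearIndepOn_extension (linearIndepOn_empty ℂ u)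
    (Set.empty_subset (Set.univ : Set (Fin k)))
  have hs : ∑ i, u i ∈ Submodule.span ℂ (u '' b) :=
    Submodule.sum_mem _ fun i _ => hspan ⟨i, Set.mem_univ _, rfl⟩
  obtain ⟨l, hl, hls⟩ := (Finsupp.mem_span_image_iff_linearCombination ℂ).mp hs
  set B := l.support with hB
  have hmem : ∀ i : Fin B.card, B.orderEmbOfFin rfl i ∈ B := fun i =>
    Finset.orderEmbOfFin_mem _ _ i
  have hne : ∀ i : Fin B.card, l (B.orderEmbOfFin rfl i) ≠ 0 := fun i =>
    Finsupp.mem_support_iff.mp (hmem i)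
  have hmono : StrictMono (B.orderEmbOfFin rfl) := (B.orderEmbOfFin rfl).strictMono
  refine ⟨B.card, fun i => l (B.orderEmbOfFin rfl i) • u (B.orderEmbOfFin rfl i), ?_, ?_, ?_,
    fun j => newtonVertexCount_flagW_le u hmono hne j⟩
  · simpa using B.card_le_univ
  · have h1 : LinearIndependent ℂ (fun i : Fin B.card => u (B.orderEmbOfFin rfl i)) := by
      refine hli.linearIndependent.comp
        (fun i : Fin B.card => (⟨B.orderEmbOfFin rfl i, hl (hmem i)⟩ : b)) fun i j hij => ?_
      have h := congrArg Subtype.val hij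
      exact hmono.injective h
    have h2 := h1.units_smul fun i => Units.mk0 _ (hne i)
    convert h2 using 1
    funext i
    rfl
  · rw [← hls, Finsupp.linearCombination_apply, Finsupp.sum]
    exact sum_orderEmbOfFin B fun x => l x • u x

/-! ## Counting chart tops through flag pairs -/

/-- **Chart tops are differences of realised flag pairs**: if every top `e` of `Σ u` (for a
generic weight) satisfies `e + top W_j = top W_{j+1}` for some `j`, then along each chart `(σ, t)`
the number of tops of `Σ u` is at most the total number of realised pairs `(top W_j, top W_{j+1})`.
[folklore] -/
theorem ncard_tops_le {n : ℕ} (u : Fin n → MvPolynomial (Fin 2) ℂ) (σ : ℝ)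
    (hS' : ∀ (w : Fin 2 → ℝ), IsGeneric w → ∀ (e : Fin 2 →₀ ℕ), IsTop w (∑ i, u i) e →
      ∃ (j : Fin n) (a b : Fin 2 →₀ ℕ),
        IsTop w (flagW u (Fin.castSucc j)) a ∧ IsTop w (flagW u j.succ) b ∧ e + a = b) :
    {e : Fin 2 →₀ ℕ | ∃ t : ℝ, IsGeneric ![σ, t] ∧ IsTop ![σ, t] (∑ i, u i) e}.ncard ≤
      ∑ j : Fin n, {ab : (Fin 2 →₀ ℕ) × (Fin 2 →₀ ℕ) | ∃ t : ℝ, IsGeneric ![σ, t] ∧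
        IsTop ![σ, t] (flagW u (Fin.castSucc j)) ab.1 ∧
          IsTop ![σ, t] (flagW u j.succ) ab.2}.ncard := by
  classical
  set P : Fin n → Set ((Fin 2 →₀ ℕ) × (Fin 2 →₀ ℕ)) := fun j => {ab | ∃ t : ℝ,
    IsGeneric ![σ, t] ∧ IsTop ![σ, t] (flagW u (Fin.castSucc j)) ab.1 ∧
      IsTop ![σ, t] (flagW u j.succ) ab.2} with hP
  have hfin : ∀ j, (P j).Finite := fun j => by
    refine (((flagW u (Fin.castSucc j)).support ×ˢ
      (flagW u j.succ).support).finite_toSet).subset ?_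
    rintro ab ⟨t, -, h1, h2⟩
    rw [Finset.coe_product]
    exact ⟨h1.mem, h2.mem⟩
  have hsub : {e : Fin 2 →₀ ℕ | ∃ t : ℝ, IsGeneric ![σ, t] ∧ IsTop ![σ, t] (∑ i, u i) e} ⊆
      ⋃ j, (fun ab : (Fin 2 →₀ ℕ) × (Fin 2 →₀ ℕ) => ab.2 - ab.1) '' P j := by
    rintro e ⟨t, hw, he⟩
    obtain ⟨j, a, b, ha, hb, hab⟩ := hS' _ hw e he
    refine Set.mem_iUnion.mpr ⟨j, (a, b), ⟨t, hw, ha, hb⟩, ?_⟩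
    show b - a = e
    rw [← hab, add_tsub_cancel_right]
  calc {e : Fin 2 →₀ ℕ | ∃ t : ℝ, IsGeneric ![σ, t] ∧ IsTop ![σ, t] (∑ i, u i) e}.ncard
      ≤ (⋃ j, (fun ab : (Fin 2 →₀ ℕ) × (Fin 2 →₀ ℕ) => ab.2 - ab.1) '' P j).ncard :=
        Set.ncard_le_ncard hsub (Set.finite_iUnion fun j => (hfin j).image _)
    _ ≤ ∑ j, ((fun ab : (Fin 2 →₀ ℕ) × (Fin 2 →₀ ℕ) => ab.2 - ab.1) '' P j).ncard :=
        Set.ncard_iUnion_le_of_fintype _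
    _ ≤ ∑ j, (P j).ncard := Finset.sum_le_sum fun j _ => Set.ncard_image_le (hfin j)

end VdpAssembly

/-- **Assembly of the Newton-polygon Voorhoeve–van der Poorten bound** (stub `stub_vdpAssembly`
of the line `euler-wronskian-vdp`): from the structure of the tops of a sum of an independent
family via flag Wronskians (`hS`), the chart pair count (`hC`) and the vertex charts (`hV`),
`V(Σ_{i<k} u_i) ≤ 4 (k+1)² · wronskianSup u`.  Proof: reduce to an independent increasing
sub-family carrying the sum with nonzero coefficients (`VdpAssembly.exists_carrier`; its flag
Wronskians are column scalings of Wronskians `W(u_T)`); `V(s) ≤ #T₊ + #T₋` (`hV`); each `T_σ` is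
covered by differences of realised flag pairs (`VdpAssembly.ncard_tops_le`); each pair set has
`≤ V(W_{j+1}) + V(W_j) ≤ 2 · wronskianSup u` elements (`hC`).
[KPT arXiv:1205.1015 §2 (real analogue); folklore] -/
theorem stub_vdpAssembly
    (hS : ∀ (k : ℕ) (u : Fin k → MvPolynomial (Fin 2) ℂ), LinearIndependent ℂ u →
      ∀ (w : Fin 2 → ℝ), IsGeneric w → ∀ (e : Fin 2 →₀ ℕ), IsTop w (∑ i, u i) e →
        ∃ (j : Fin k) (a b : Fin 2 →₀ ℕ),
          IsTop w (flagW u (Fin.castSucc j)) a ∧ IsTop w (flagW u j.succ) b ∧ e + a = b)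
    (hC : ∀ (σ : ℝ), (σ = 1 ∨ σ = -1) → ∀ (F G : MvPolynomial (Fin 2) Slope),
      {ab : (Fin 2 →₀ ℕ) × (Fin 2 →₀ ℕ) |
          ∃ t : ℝ, IsGeneric ![σ, t] ∧ IsTop ![σ, t] G ab.1 ∧ IsTop ![σ, t] F ab.2}.ncard ≤
        newtonVertexCount F + newtonVertexCount G)
    (hV : ∀ (s : MvPolynomial (Fin 2) ℂ),
      newtonVertexCount s ≤
        {e : Fin 2 →₀ ℕ | ∃ t : ℝ, IsGeneric ![(1 : ℝ), t] ∧ IsTop ![(1 : ℝ), t] s e}.ncard +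
          {e : Fin 2 →₀ ℕ | ∃ t : ℝ, IsGeneric ![(-1 : ℝ), t] ∧ IsTop ![(-1 : ℝ), t] s e}.ncard) :
    ∃ c : ℕ, ∀ (k : ℕ) (u : Fin k → MvPolynomial (Fin 2) ℂ),
      newtonVertexCount (∑ i, u i) ≤ c * (k + 1) ^ 2 * wronskianSup u := by
  refine ⟨4, fun k u => ?_⟩
  obtain ⟨n, u', hn, hli, hsum, hW⟩ := VdpAssembly.exists_carrier u
  have hT : ∀ σ : ℝ, (σ = 1 ∨ σ = -1) →
      {e : Fin 2 →₀ ℕ | ∃ t : ℝ, IsGeneric ![σ, t] ∧ IsTop ![σ, t] (∑ i, u i) e}.ncard ≤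
        n * (2 * wronskianSup u) := by
    intro σ hσ
    rw [← hsum]
    calc {e : Fin 2 →₀ ℕ | ∃ t : ℝ, IsGeneric ![σ, t] ∧ IsTop ![σ, t] (∑ i, u' i) e}.ncard
        ≤ ∑ j : Fin n, {ab : (Fin 2 →₀ ℕ) × (Fin 2 →₀ ℕ) | ∃ t : ℝ, IsGeneric ![σ, t] ∧
            IsTop ![σ, t] (flagW u' (Fin.castSucc j)) ab.1 ∧
              IsTop ![σ, t] (flagW u' j.succ) ab.2}.ncard :=
          VdpAssembly.ncard_tops_le u' σ (hS n u' hli)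
      _ ≤ ∑ j : Fin n, (newtonVertexCount (flagW u' j.succ) +
            newtonVertexCount (flagW u' (Fin.castSucc j))) :=
          Finset.sum_le_sum fun j _ => hC σ hσ _ _
      _ ≤ ∑ _j : Fin n, 2 * wronskianSup u :=
          Finset.sum_le_sum fun j _ => by
            have h1 := hW j.succ
            have h2 := hW (Fin.castSucc j)
            omega
      _ = n * (2 * wronskianSup u) := by simp
  have hnk : n ≤ (k + 1) ^ 2 := hn.trans (by nlinarith)
  calc newtonVertexCount (∑ i, u i) ≤ _ := hV _
    _ ≤ n * (2 * wronskianSup u) + n * (2 * wronskianSup u) :=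
        add_le_add (hT 1 (Or.inl rfl)) (hT (-1) (Or.inr rfl))
    _ = 4 * n * wronskianSup u := by ring
    _ ≤ 4 * (k + 1) ^ 2 * wronskianSup u := by gcongr

end Summit.ValiantsHypothesis.ValiantsHypothesis.Theorems.NewtonUnitEquationsNewtonTauWeak

end
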